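import Summits.RiemannHypothesis.RiemannHypothesis.Theorems.SpectralTraceHeckeSurrogateDefs
import Summits.RiemannHypothesis.RiemannHypothesis.Theorems.SpectralTraceWindowTracePrime2StubLogDerivDiff
import Literature.Uncategorized.GammaLowerBound
import Literature.Analysis.Complex.BacklundJensenAverage
import Literature.Analysis.Complex.LogDerivZerosDisc
import HarnessLib

/-!
# Vertical distribution of the zeros of a surrogate — stub `stub_zeroCount`

Route `RiemannHypothesis/SpectralTrace`, crux `WindowTracePrime2` (stmt-RiemannHypothesis-11196),
line `hecke-cusp-perturbation-surrogate`, registered stub **B**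
`stub_zeroCount : GammaLowerBound → (∀ E, IsSurrogate E → RightHalfPlaneControl E) →
  ∀ E, IsSurrogate E → ZeroCountBound E`
(skeleton `Cruxes/WindowTracePrime2/Lines/hecke_cusp_perturbation_surrogate.lean`; vocabulary
`Theorems/SpectralTraceHeckeSurrogateDefs.lean`: `IsSurrogate`, `RightHalfPlaneControl`,
`ZeroCountBound`, `ZIdx`, `zval`; the hypothesis `Literature.Uncategorized.GammaLowerBound`).

For a surrogate `E` (entire, `‖E(s)‖ ≤ C exp(A‖s‖ log(1+‖s‖))`, `E(1-s) = E(s)`) controlled on the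
right half-plane `Re s ≥ σ₁` by `‖s(s-1)Γ_ℝ(s)‖ ≤ 2‖E(s)‖`:

* (a) `E ≠ 0` on `Re s ≥ σ₁` (`s(s-1)Γ_ℝ(s) ≠ 0` there) and, by the functional equation, on
  `Re s ≤ 1 - σ₁`; so every zero has `|Re ρ - 1/2| < σ₁`.
* (b) Jensen's inequality in the mean form `Literature.Analysis.Complex.sum_divisor_le_of_circleAverage_le`
  on the discs of radii `r = σ_c + σ₁ < 2r` about `c = σ_c + iT`, `σ_c = 2n + 1`, `n = ⌈σ₁⌉`:
  the small disc contains every zero with `|Im ρ - T| ≤ 1`; on the big circle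
  `log ‖E‖ ≤ B + B (σ_c + 2r + |T|)²` from the order-`≤ 1` bound (`log(1+x) ≤ x`); at the centre
  `‖E(c)‖ ≥ ½‖c(c-1)Γ_ℝ(c)‖ ≥ (q/2) e^{-|T|}` from `Γ_ℝ(s) = π^{-s/2}Γ(s/2)`, `c/2 = 1/2 + n + iT/2`
  and the Gamma lower bound `|Γ(1/2 + n + iy)| ≥ √π e^{-π|y|/2} 2^{-n}`. Hence the total
  multiplicity in the small disc is `≤ A₀ (2 + |T|)²`.
* (c) Multiplicity bookkeeping: the window's indices `⟨ρ, k⟩` (`k < ord_ρ E`) inject into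
  `⋃_ρ {ρ} × [0, ord_ρ E)` over the finite support of the divisor of `E` on the small disc, whose
  size is the Jensen sum (`divisor = analyticOrderNatAt` for analytic `E`).

One constant `A = max(A₀, 2, σ₁)` serves the strip, the count and the exponent
(`(2+|T|)² ≤ (2+|T|)^A`).

References: E. C. Titchmarsh, *The theory of the Riemann zeta-function* (1986), §9.2 (Jensen's
formula and the local zero count), §9.4 [Titchmarsh1986].
-/

noncomputable section

set_option linter.dupNamespace false

namespace Summit.RiemannHypothesis.RiemannHypothesis.Theorems.HeckeSurrogate

open Complex Filter Set MeasureTheory Metric MeromorphicOn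
open scoped Real Topology
open Literature.NumberTheory.LFunctions
open Literature.Uncategorized

/-- For `E` analytic on a neighbourhood of `U` and `ρ ∈ U`, the divisor of `E` on `U` at `ρ` is the
order of vanishing `analyticOrderNatAt E ρ` (both are `0` when `E` vanishes identically near `ρ`).
[folklore] -/
theorem zc_divisor_eq_analyticOrderNatAt {E : ℂ → ℂ} {U : Set ℂ} (hE : AnalyticOnNhd ℂ E U)
    {ρ : ℂ} (hρ : ρ ∈ U) : MeromorphicOn.divisor E U ρ = (analyticOrderNatAt E ρ : ℤ) := by
  rw [hE.divisor_apply hρ, analyticOrderNatAt]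
  cases analyticOrderAt E ρ with
  | top => simp
  | coe n => simp

/-- The index map `⟨ρ, k⟩ ↦ (ρ, k)` from the zeros-with-multiplicity of `E` to `ℂ × ℕ` is
injective. [folklore] -/
theorem zc_index_injective (E : ℂ → ℂ) :
    Function.Injective (fun i : ZIdx E => (zval i, (i.2 : ℕ))) := by
  rintro ⟨⟨ρ, hρ⟩, ⟨k, hk⟩⟩ ⟨⟨ρ', hρ'⟩, ⟨k', hk'⟩⟩ h
  simp only [zval, Prod.mk.injEq] at h
  obtain ⟨rfl, rfl⟩ := h
  rfl

/-- From the order-`≤ 1` growth bound `‖E(s)‖ ≤ C exp(A‖s‖ log(1+‖s‖))`: a bound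
`log ‖E(z)‖ ≤ B + B X²` on every disc `‖z‖ ≤ X` (`log(1+X) ≤ X`). [folklore] -/
theorem zc_log_norm_le {E : ℂ → ℂ}
    (h : ∃ A C : ℝ, ∀ s : ℂ, ‖E s‖ ≤ C * Real.exp (A * ‖s‖ * Real.log (1 + ‖s‖))) :
    ∃ B : ℝ, 0 ≤ B ∧ ∀ (X : ℝ) (z : ℂ), ‖z‖ ≤ X → Real.log ‖E z‖ ≤ B + B * X ^ 2 := by
  obtain ⟨A, C, h⟩ := h
  have hA' : 0 ≤ max A 0 := le_max_right _ _
  have hC' : 1 ≤ max C 1 := le_max_right _ _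
  set B : ℝ := max (Real.log (max C 1)) (max A 0) with hB
  have hB0 : 0 ≤ B := le_trans hA' (le_max_right _ _)
  refine ⟨B, hB0, fun X z hz => ?_⟩
  have hX : 0 ≤ X := (norm_nonneg z).trans hz
  have hrhs : 0 ≤ B + B * X ^ 2 := by positivity
  rcases eq_or_ne (E z) 0 with h0 | h0
  · rw [h0, norm_zero, Real.log_zero]; exact hrhs
  have hpos : 0 < ‖E z‖ := norm_pos_iff.2 h0
  have hlog1 : Real.log (1 + ‖z‖) ≤ Real.log (1 + X) :=
    Real.log_le_log (by positivity) (by linarith)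
  have hlogX : Real.log (1 + X) ≤ X := by
    have := Real.log_le_sub_one_of_pos (show 0 < 1 + X by positivity); linarith
  have hlog0 : 0 ≤ Real.log (1 + ‖z‖) := Real.log_nonneg (by linarith [norm_nonneg z])
  have hu : A * ‖z‖ * Real.log (1 + ‖z‖) ≤ max A 0 * X * X := by
    calc A * ‖z‖ * Real.log (1 + ‖z‖) ≤ max A 0 * ‖z‖ * Real.log (1 + ‖z‖) := by
          have : 0 ≤ ‖z‖ * Real.log (1 + ‖z‖) := mul_nonneg (norm_nonneg z) hlog0
          nlinarith [le_max_left A 0]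
      _ = max A 0 * (‖z‖ * Real.log (1 + ‖z‖)) := by ring
      _ ≤ max A 0 * (X * X) := by
          refine mul_le_mul_of_nonneg_left ?_ hA'
          exact mul_le_mul hz (hlog1.trans hlogX) hlog0 hX
      _ = max A 0 * X * X := by ring
  have h1 : ‖E z‖ ≤ max C 1 * Real.exp (max A 0 * X * X) := by
    calc ‖E z‖ ≤ C * Real.exp (A * ‖z‖ * Real.log (1 + ‖z‖)) := h z
      _ ≤ max C 1 * Real.exp (A * ‖z‖ * Real.log (1 + ‖z‖)) :=
          mul_le_mul_of_nonneg_right (le_max_left _ _) (Real.exp_pos _).le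
      _ ≤ max C 1 * Real.exp (max A 0 * X * X) := by gcongr
  have h2 : Real.log ‖E z‖ ≤ Real.log (max C 1) + max A 0 * X * X := by
    have := Real.log_le_log hpos h1
    rwa [Real.log_mul (by positivity) (Real.exp_pos _).ne', Real.log_exp] at this
  have h3 : Real.log (max C 1) ≤ B := le_max_left _ _
  have h4 : max A 0 * X * X ≤ B * X ^ 2 := by
    rw [sq, ← mul_assoc]
    exact mul_le_mul_of_nonneg_right (mul_le_mul_of_nonneg_right (le_max_right _ _) hX) hX
  linarith

/-- **Lower bound at the Jensen centres** `c = 2n+1 + iT` (`n ≥ 1`): `‖c(c-1)Γ_ℝ(c)‖ ≥ q e^{-|T|}`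
with `q = π^{-(2n+1)/2} √π 2^{-n} > 0`, from `Γ_ℝ(s) = π^{-s/2}Γ(s/2)`, `c/2 = 1/2 + n + iT/2`,
the Gamma lower bound `|Γ(1/2 + n + iy)| ≥ √π e^{-π|y|/2} 2^{-n}` and `π ≤ 4`. [folklore] -/
theorem zc_centre_lower (hΓ : GammaLowerBound) {n : ℕ} (hn : 1 ≤ n) :
    ∃ q : ℝ, 0 < q ∧ ∀ T : ℝ,
      q * Real.exp (-|T|) ≤ ‖(2 * (n : ℂ) + 1 + T * I) * ((2 * (n : ℂ) + 1 + T * I) - 1) *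
        (2 * (n : ℂ) + 1 + T * I).Gammaℝ‖ := by
  refine ⟨π ^ (-((2 * (n : ℝ) + 1) / 2)) * (Real.sqrt π * (1 / 2) ^ n), by positivity,
    fun T => ?_⟩
  set c : ℂ := 2 * (n : ℂ) + 1 + T * I with hc
  have hn' : (1 : ℝ) ≤ n := by exact_mod_cast hn
  have hcre : c.re = 2 * n + 1 := by simp [hc]
  have hc1 : 1 ≤ ‖c‖ := by
    refine le_trans ?_ (Complex.re_le_norm c)
    rw [hcre]; linarith
  have hc2 : 1 ≤ ‖c - 1‖ := by
    refine le_trans ?_ (Complex.re_le_norm (c - 1))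
    rw [sub_re, hcre, one_re]; linarith
  -- the Gamma factor
  have hhalf : c / 2 = 1 / 2 + (n : ℂ) + ((T / 2 : ℝ) : ℂ) * I := by
    rw [hc]; push_cast; ring
  have hpow : ‖(π : ℂ) ^ (-c / 2)‖ = π ^ (-((2 * (n : ℝ) + 1) / 2)) := by
    rw [Complex.norm_cpow_eq_rpow_re_of_pos Real.pi_pos]
    congr 1
    rw [neg_div, neg_re, Complex.div_re]
    simp [hcre]
    ring
  have hG := hΓ n (T / 2)
  have hexp : Real.exp (-|T|) ≤ Real.exp (-(π / 2) * |T / 2|) := by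
    rw [Real.exp_le_exp, abs_div, abs_two]
    nlinarith [Real.pi_le_four, abs_nonneg T]
  have hGam : Real.sqrt π * (1 / 2) ^ n * Real.exp (-|T|) ≤ ‖Complex.Gamma (c / 2)‖ := by
    rw [hhalf]
    calc Real.sqrt π * (1 / 2) ^ n * Real.exp (-|T|)
        ≤ Real.sqrt π * (1 / 2) ^ n * Real.exp (-(π / 2) * |T / 2|) := by gcongr
      _ = Real.sqrt π * Real.exp (-(π / 2) * |T / 2|) * (1 / 2) ^ n := by ring
      _ ≤ _ := hG
  have hGR : π ^ (-((2 * (n : ℝ) + 1) / 2)) * (Real.sqrt π * (1 / 2) ^ n) * Real.exp (-|T|) ≤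
      ‖c.Gammaℝ‖ := by
    rw [Gammaℝ_def, norm_mul, hpow, mul_assoc]
    exact mul_le_mul_of_nonneg_left hGam (by positivity)
  calc π ^ (-((2 * (n : ℝ) + 1) / 2)) * (Real.sqrt π * (1 / 2) ^ n) * Real.exp (-|T|)
      ≤ ‖c.Gammaℝ‖ := hGR
    _ = 1 * 1 * ‖c.Gammaℝ‖ := by ring
    _ ≤ ‖c‖ * ‖c - 1‖ * ‖c.Gammaℝ‖ := by gcongr
    _ = ‖c * (c - 1) * c.Gammaℝ‖ := by rw [norm_mul, norm_mul]

/-- **Multiplicity bookkeeping.** If every zero `ρ` of the entire function `E` with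
`|Im ρ - T| ≤ 1` lies in the disc `‖ρ - c‖ ≤ r`, then the zeros-with-multiplicity of `E` in the window
`|Im ρ - T| ≤ 1` form a finite set of size at most `Σ_u divisor E (closedBall c r) u` (the index
`⟨ρ, k⟩ ↦ (ρ, k)` injects into `⋃_ρ {ρ} × [0, ord_ρ E)` over the finite support of the divisor).
[folklore] -/
theorem zc_ncard_le_finsum {E : ℂ → ℂ} (hEd : Differentiable ℂ E) {c : ℂ} {r T : ℝ}
    (hin : ∀ ρ : ℂ, E ρ = 0 → |ρ.im - T| ≤ 1 → ρ ∈ closedBall c r) :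
    {i : ZIdx E | |(zval i).im - T| ≤ 1}.Finite ∧
      (({i : ZIdx E | |(zval i).im - T| ≤ 1}.ncard : ℕ) : ℝ) ≤
        ((∑ᶠ u, divisor E (closedBall c r) u : ℤ) : ℝ) := by
  classical
  set U := closedBall c r with hU
  have hEU : AnalyticOnNhd ℂ E U := fun z _ => hEd.analyticAt z
  set D := divisor E U with hD
  have hDfin : D.support.Finite := D.finiteSupport (isCompact_closedBall c r)
  set S := hDfin.toFinset with hS
  have hDeq : ∀ ρ ∈ U, D ρ = (analyticOrderNatAt E ρ : ℤ) := fun ρ hρ =>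
    zc_divisor_eq_analyticOrderNatAt hEU hρ
  -- the finite set of pairs `(ρ, k)`, `k < ord_ρ E`, over the support of the divisor
  set W : Finset (ℂ × ℕ) :=
    S.biUnion fun ρ => ({ρ} : Finset ℂ) ×ˢ Finset.range (analyticOrderNatAt E ρ) with hW
  set f : ZIdx E → ℂ × ℕ := fun i => (zval i, (i.2 : ℕ)) with hf
  have hmaps : ∀ i ∈ {i : ZIdx E | |(zval i).im - T| ≤ 1}, f i ∈ (W : Set (ℂ × ℕ)) := by
    intro i hi
    rw [Set.mem_setOf_eq] at hi
    have hρ0 : E (zval i) = 0 := i.1.2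
    have hρU : zval i ∈ U := hin _ hρ0 hi
    have hk : (i.2 : ℕ) < analyticOrderNatAt E (zval i) := i.2.isLt
    have hpos : 0 < analyticOrderNatAt E (zval i) := lt_of_le_of_lt (Nat.zero_le _) hk
    rw [Finset.mem_coe, hW, Finset.mem_biUnion]
    refine ⟨zval i, ?_, ?_⟩
    · rw [hS, Set.Finite.mem_toFinset, Function.mem_support, hDeq _ hρU]
      exact_mod_cast hpos.ne'
    · rw [Finset.mem_product, Finset.mem_singleton, Finset.mem_range]
      exact ⟨rfl, hk⟩
  have hinj : Set.InjOn f {i : ZIdx E | |(zval i).im - T| ≤ 1} := (zc_index_injective E).injOn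
  refine ⟨Set.Finite.of_injOn hmaps hinj W.finite_toSet, ?_⟩
  have h1 : {i : ZIdx E | |(zval i).im - T| ≤ 1}.ncard ≤ (W : Set (ℂ × ℕ)).ncard :=
    Set.ncard_le_ncard_of_injOn f hmaps hinj W.finite_toSet
  rw [Set.ncard_coe_finset] at h1
  have h2 : W.card ≤ ∑ ρ ∈ S, analyticOrderNatAt E ρ := by
    refine Finset.card_biUnion_le.trans (le_of_eq (Finset.sum_congr rfl fun ρ _ => ?_))
    rw [Finset.card_product, Finset.card_singleton, Finset.card_range, one_mul]
  have h3 : (∑ᶠ u, D u) = ∑ ρ ∈ S, D ρ := finsum_eq_sum_of_support_subset _ (by simp [hS])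
  have h4 : ∑ ρ ∈ S, D ρ = ∑ ρ ∈ S, (analyticOrderNatAt E ρ : ℤ) :=
    Finset.sum_congr rfl fun ρ hρ => hDeq ρ (D.supportWithinDomain (by simpa [hS] using hρ))
  rw [h3, h4]
  push_cast
  exact_mod_cast h1.trans h2

/-- **`stub_zeroCount`** (registered stub B of the line `hecke-cusp-perturbation-surrogate`, crux
stmt-RiemannHypothesis-11196): the zeros of a surrogate `E` lie in a vertical strip and the number
of zeros with `|Im ρ - T| ≤ 1`, counted with multiplicity, is finite and `≤ A (2+|T|)^A`.
(a) By the right half-plane control `‖s(s-1)Γ_ℝ(s)‖ ≤ 2‖E(s)‖`, `E ≠ 0` on `Re s ≥ σ₁`, and by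
`E(1-s) = E(s)` on `Re s ≤ 1 - σ₁`. (b) Jensen's inequality in the mean form
(`Literature.Analysis.Complex.sum_divisor_le_of_circleAverage_le`) on the discs of radii
`r = σ_c + σ₁ < 2r` about `c = σ_c + iT`, `σ_c = 2⌈σ₁⌉ + 1`: on the big circle
`log ‖E‖ ≤ B + B(σ_c + 2r + |T|)²` (order `≤ 1`), and at the centre
`log ‖E(c)‖ ≥ log(q/2) - |T|` (`|Γ(1/2 + n + iy)| ≥ √π e^{-π|y|/2} 2^{-n}`). (c) The window's
zeros-with-multiplicity inject into the support of the divisor with its multiplicities.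
[cite: Titchmarsh1986, §9.2] -/
theorem stub_zeroCount :
    GammaLowerBound → (∀ E : ℂ → ℂ, IsSurrogate E → RightHalfPlaneControl E) →
      ∀ E : ℂ → ℂ, IsSurrogate E → ZeroCountBound E := by
  intro hΓ hRHP E hE
  obtain ⟨σ₁, -, hσ₁, -, hdom, -⟩ := hRHP E hE
  have hEd : Differentiable ℂ E := hE.1
  obtain ⟨B, hB0, hB⟩ := zc_log_norm_le hE.2.1
  have hFE : ∀ s : ℂ, E (1 - s) = E s := hE.2.2.1
  -- (a) the zero-free half-planes
  have hne : ∀ s : ℂ, σ₁ ≤ s.re → E s ≠ 0 := by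
    intro s hs h0
    have h1 := hdom s hs
    rw [h0, norm_zero, mul_zero] at h1
    exact polarFactor_ne_zero (by linarith) (norm_le_zero_iff.1 h1)
  have hstrip : ∀ s : ℂ, E s = 0 → 1 - σ₁ < s.re ∧ s.re < σ₁ := by
    intro s h0
    constructor
    · by_contra h
      push Not at h
      have h1 : σ₁ ≤ (1 - s).re := by rw [sub_re, one_re]; linarith
      exact hne (1 - s) h1 (by rw [hFE]; exact h0)
    · by_contra h
      push Not at h
      exact hne s h h0
  -- the abscissa of the centres: `σ_c = 2n + 1 ≥ σ₁`, `n ≥ 1`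
  obtain ⟨n, hn1, hnσ⟩ : ∃ n : ℕ, 1 ≤ n ∧ σ₁ ≤ n :=
    ⟨⌈σ₁⌉₊, Nat.ceil_pos.2 (by linarith), Nat.le_ceil σ₁⟩
  obtain ⟨σc, hσc⟩ : ∃ σc : ℝ, σc = 2 * n + 1 := ⟨_, rfl⟩
  have hn0 : (0 : ℝ) ≤ n := n.cast_nonneg
  have hσc1 : σ₁ ≤ σc := by rw [hσc]; linarith
  have hσc0 : 0 < σc := by linarith
  obtain ⟨q, hq0, hq⟩ := zc_centre_lower hΓ hn1
  obtain ⟨r, hr⟩ : ∃ r : ℝ, r = σc + σ₁ := ⟨_, rfl⟩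
  have hr0 : 0 < r := by rw [hr]; linarith
  obtain ⟨K₂, hK₂⟩ : ∃ K₂ : ℝ, K₂ = σc + 2 * r := ⟨_, rfl⟩
  have hK₂1 : 1 ≤ K₂ := by rw [hK₂]; linarith
  have hl2 : 0 < Real.log 2 := Real.log_pos one_lt_two
  obtain ⟨A₀, hA₀⟩ : ∃ A₀ : ℝ, A₀ = (B + B * K₂ ^ 2 + |Real.log (q / 2)| + 1) / Real.log 2 :=
    ⟨_, rfl⟩
  have hA₀0 : 0 ≤ A₀ := by rw [hA₀]; positivity
  set A : ℝ := max (max A₀ 2) σ₁ with hA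
  have hA2 : (2 : ℝ) ≤ A := le_trans (le_max_right _ _) (le_max_left _ _)
  have hAA₀ : A₀ ≤ A := le_trans (le_max_left _ _) (le_max_left _ _)
  have hAσ : σ₁ ≤ A := le_max_right _ _
  refine ⟨A, fun s h0 => ?_, fun T => ?_⟩
  · -- the strip
    obtain ⟨h1, h2⟩ := hstrip s h0
    rw [abs_le]
    constructor <;> linarith
  · -- the window at height `T`
    set c : ℂ := 2 * (n : ℂ) + 1 + T * I with hc
    have hcre : c.re = σc := by rw [hσc]; simp [hc]
    have hcim : c.im = T := by simp [hc]
    -- the window's zeros lie in `closedBall c r`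
    have hin : ∀ ρ : ℂ, E ρ = 0 → |ρ.im - T| ≤ 1 → ρ ∈ closedBall c r := by
      intro ρ h0 hT
      obtain ⟨h1, h2⟩ := hstrip ρ h0
      rw [mem_closedBall, dist_eq_norm]
      have hre : |(ρ - c).re| ≤ σc + σ₁ - 1 := by
        rw [sub_re, hcre, abs_le]; constructor <;> linarith
      have him : |(ρ - c).im| ≤ 1 := by rw [sub_im, hcim]; exact hT
      calc ‖ρ - c‖ ≤ |(ρ - c).re| + |(ρ - c).im| := Complex.norm_le_abs_re_add_abs_im _
        _ ≤ r := by rw [hr]; linarith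
    obtain ⟨hfin, hcount⟩ := zc_ncard_le_finsum hEd hin
    refine ⟨hfin, hcount.trans ?_⟩
    -- Jensen's inequality in the mean form on the discs of radii `r < 2r` about `c`
    have hEan : AnalyticOnNhd ℂ E (closedBall c (2 * r)) := fun z _ => hEd.analyticAt z
    have hEc : E c ≠ 0 := hne c (by rw [hcre]; exact hσc1)
    have hX : ∀ z ∈ sphere c |2 * r|, Real.log ‖E z‖ ≤ B + B * (K₂ + |T|) ^ 2 := by
      intro z hz
      refine hB (K₂ + |T|) z ?_
      rw [mem_sphere, dist_eq_norm, abs_of_pos (by positivity)] at hz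
      have hcn : ‖c‖ ≤ σc + |T| := by
        calc ‖c‖ ≤ |c.re| + |c.im| := Complex.norm_le_abs_re_add_abs_im c
          _ = σc + |T| := by rw [hcre, hcim, abs_of_pos hσc0]
      calc ‖z‖ = ‖(z - c) + c‖ := by rw [sub_add_cancel]
        _ ≤ ‖z - c‖ + ‖c‖ := norm_add_le _ _
        _ ≤ K₂ + |T| := by rw [hz, hK₂]; linarith
    have hsph : sphere c |2 * r| ⊆ closedBall c (2 * r) := by
      rw [abs_of_pos (by positivity)]; exact sphere_subset_closedBall
    have hint : CircleIntegrable (fun z => Real.log ‖E z‖) c (2 * r) :=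
      (hEan.mono hsph).meromorphicOn.circleIntegrable_log_norm
    have hAvg : Real.circleAverage (fun z => Real.log ‖E z‖) c (2 * r) ≤
        B + B * (K₂ + |T|) ^ 2 :=
      Real.circleAverage_mono_on_of_le_circle hint hX
    have hJ := Literature.Analysis.Complex.sum_divisor_le_of_circleAverage_le (r := r)
      (R := 2 * r) hr0 (by linarith) hEan hEc hAvg
    have hlog2 : Real.log (2 * r / r) = Real.log 2 := by
      rw [mul_div_assoc, div_self hr0.ne', mul_one]
    rw [hlog2] at hJ
    refine hJ.trans ?_
    -- the centre: `log ‖E c‖ ≥ log (q/2) - |T|`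
    have hEc_low : Real.log (q / 2) - |T| ≤ Real.log ‖E c‖ := by
      have h1 := hdom c (by rw [hcre]; exact hσc1)
      have h2 : q * Real.exp (-|T|) ≤ ‖c * (c - 1) * c.Gammaℝ‖ := hq T
      have h3 : q / 2 * Real.exp (-|T|) ≤ ‖E c‖ := by linarith
      have h4 := Real.log_le_log (by positivity) h3
      rwa [Real.log_mul (by positivity) (Real.exp_pos _).ne', Real.log_exp] at h4
    -- arithmetic: everything is `≤ const · (2 + |T|)²`
    have hT0 : 0 ≤ |T| := abs_nonneg T
    have hXle : K₂ + |T| ≤ K₂ * (2 + |T|) := by nlinarith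
    have hX2 : (K₂ + |T|) ^ 2 ≤ K₂ ^ 2 * (2 + |T|) ^ 2 := by
      rw [← mul_pow]; exact pow_le_pow_left₀ (by positivity) hXle 2
    have hsq1 : 1 ≤ (2 + |T|) ^ 2 := by nlinarith
    have hsqT : |T| ≤ (2 + |T|) ^ 2 := by nlinarith
    have hnum : B + B * (K₂ + |T|) ^ 2 - Real.log ‖E c‖ ≤
        (B + B * K₂ ^ 2 + |Real.log (q / 2)| + 1) * (2 + |T|) ^ 2 := by
      have e1 : B ≤ B * (2 + |T|) ^ 2 := le_mul_of_one_le_right hB0 hsq1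
      have e2 : B * (K₂ + |T|) ^ 2 ≤ B * K₂ ^ 2 * (2 + |T|) ^ 2 := by
        rw [mul_assoc]; exact mul_le_mul_of_nonneg_left hX2 hB0
      have e3 : -Real.log ‖E c‖ ≤ |Real.log (q / 2)| * (2 + |T|) ^ 2 + (2 + |T|) ^ 2 := by
        have f1 : -Real.log (q / 2) ≤ |Real.log (q / 2)| := neg_le_abs _
        have f2 : |Real.log (q / 2)| ≤ |Real.log (q / 2)| * (2 + |T|) ^ 2 :=
          le_mul_of_one_le_right (abs_nonneg _) hsq1
        linarith
      have e4 : (B + B * K₂ ^ 2 + |Real.log (q / 2)| + 1) * (2 + |T|) ^ 2 =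
          B * (2 + |T|) ^ 2 + B * K₂ ^ 2 * (2 + |T|) ^ 2 +
            (|Real.log (q / 2)| * (2 + |T|) ^ 2 + (2 + |T|) ^ 2) := by ring
      linarith
    have hstep : (B + B * (K₂ + |T|) ^ 2 - Real.log ‖E c‖) / Real.log 2 ≤
        A₀ * (2 + |T|) ^ 2 := by
      rw [hA₀, div_mul_eq_mul_div]
      exact div_le_div_of_nonneg_right hnum hl2.le
    refine hstep.trans ?_
    have hbase : (1 : ℝ) ≤ 2 + |T| := by linarith
    rw [← Real.rpow_two]
    exact mul_le_mul hAA₀ (Real.rpow_le_rpow_of_exponent_le hbase hA2) (by positivity)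
      (by linarith)

end Summit.RiemannHypothesis.RiemannHypothesis.Theorems.HeckeSurrogate

end
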